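import Mathlib
import HarnessLib
import Summits.HubbardSuperconductivity.HubbardSuperconductivity.Theorems.KLProgrammeKLRegimeEngineTowerChernoff

/-!
# Route `KLProgramme` — crux K3 ENGINE (stmt-HubbardSuperconductivity-20437 `KLRegimeEngineV17F2`), stub (b): the blocked-tower bookkeeping,
# part 5b — the induction over blocks with the SIX-LEG re-measurement ratio as its own parameter (E1 lead r2d-p2 g5; k3c2-p3 KL l.2962)

* **`towerBorn_le_law₄`** (T3₄) — as `towerBorn_le_law₃` (part 4), except that (Hμ) at ratio `g` is asked only in degrees `2m ≥ 8` (there the tree's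
  `L−2` count already gives ≥ one `g` per block), the SIX-LEG re-measurement is `μ k 3 ≤ Σ_{k'≤k} c₁c₂³ g₃^{k+1−k'} b k' 3` at any ratio `g₃ ∈ [0,1)`
  (count exponent `4 − η`), `ι₃ ≥ c₁c₂³AQ³·g₃/(1−g₃)` names the six-leg import, and the Chernoff data are four-piece
  (`y = Φτ(ι₁λ + ι₂/(2Q') + ι₃/(4Q'²) + A'Q'/4) < 1`, four-piece `θ̄ < 1`, closing inequality at `p = 3`):
  ⊢ `∀ k ≤ K, ∀ 3 ≤ p ≤ D, b k p ≤ Aλ^{p−1}Q^p`.  With `g₃ = g` it reproduces T3♯; with `g₃ = 2^{−ηd}` it is what any strictly sub-marginal torus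
  six-count supports — the full `L−3` (BGM03 §7) then only improves numerals.
Pure real analysis; nothing about the model is asserted.
-/

noncomputable section

namespace Summit.HubbardSuperconductivity.HubbardSuperconductivity.Theorems.EngineV8

set_option linter.dupNamespace false -- summit = problem name (single-conjunct summit), D-0017

open Real Finset

/-! ## §3 (T3₄) The induction over blocks with the six-leg ratio `g₃` -/

/-- **(T3₄) The blocked birth-level tower closes with a separate six-leg re-measurement ratio.**  As `towerBorn_le_law₃` (part 4), except that the
re-measurement hypothesis (Hμ) at ratio `g` is asked only in degrees `2m ≥ 8`, the SIX-LEG re-measurement is `μ k 3 ≤ Σ_{k'≤k} c₁c₂³ g₃^{k+1−k'} b k' 3`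
at any ratio `g₃ ∈ [0,1)` (count exponent `4 − η`, `g₃ = 2^{−ηd}`), `ι₃ ≥ c₁c₂³AQ³·g₃/(1−g₃)` names the resulting six-leg import, and the Chernoff data
are four-piece: `y = Φτ(ι₁λ + ι₂/(2Q') + ι₃/(4Q'²) + A'Q'/4) < 1`, `θ̄ < 1` with the four-piece `V̄`, closing inequality at `p = 3` with the same `Y`.
Conclusion: `∀ k ≤ K, ∀ 3 ≤ p ≤ D, b k p ≤ A λ^{p−1} Q^p`. -/
theorem towerBorn_le_law₄ {D K : ℕ} {b μ : ℕ → ℕ → ℝ} {A lam Q g g₃ c₁ c₂ σ Φ ψ τ A' Q' ι₁ ι₂ ι₃ : ℝ}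
    (hA : 0 ≤ A) (hlam : 0 < lam) (hQ : 0 ≤ Q) (hg0 : 0 < g) (hg1 : g < 1) (hg₃0 : 0 ≤ g₃) (hg₃1 : g₃ < 1) (hc₁ : 0 ≤ c₁) (hc₂ : 0 ≤ c₂)
    (hσ : 0 ≤ σ) (hΦ : 0 ≤ Φ) (hψ : 0 ≤ ψ) (hτ : 0 < τ) (hQ'0 : 0 < Q') (hA'ge : c₁ * A / ((1 - g) * g ^ 2) ≤ A') (hQ'ge : c₂ * g * Q ≤ Q')
    (hι₃ge : c₁ * c₂ ^ 3 * A * Q ^ 3 * (g₃ / (1 - g₃)) ≤ ι₃)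
    (hb0 : ∀ k m, 0 ≤ b k m) (hμ0 : ∀ k m, 0 ≤ μ k m)
    (h0 : ∀ p, 3 ≤ p → p ≤ D → b 0 p ≤ A * lam ^ (p - 1) * Q ^ p)
    (hμ : ∀ k < K, ∀ m, 4 ≤ m → m ≤ D →
      μ k m ≤ ∑ k' ∈ range (k + 1), c₁ * c₂ ^ m * g ^ ((m - 2) * (k + 1 - k')) * b k' m)
    (hμ3 : ∀ k < K, 3 ≤ D → μ k 3 ≤ ∑ k' ∈ range (k + 1), c₁ * c₂ ^ 3 * g₃ ^ (k + 1 - k') * b k' 3)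
    (hι₁ : ∀ k < K, μ k 1 ≤ ι₁ * lam) (hι₂ : ∀ k < K, μ k 2 ≤ ι₂ * lam)
    (hstep : ∀ k < K, ∀ N : ℕ, 2 ≤ N → ∀ p, 3 ≤ p → p ≤ D → Φ * towerV D τ (μ k) < 1 →
      b (k + 1) p ≤ towerFO D σ (μ k) p + ∑ n ∈ Icc 2 N, exp 1 * Φ ^ (n - 1) * ψ ^ p * towerS D τ (μ k) n p +
        ψ ^ p * exp 1 * towerV D τ (μ k) * (Φ * towerV D τ (μ k)) ^ N / (1 - Φ * towerV D τ (μ k)))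
    (hx₁ : 4 * σ * lam * Q' < 1) (hx₂ : 2 * lam * τ * Q' ≤ 1) (hx₃ : exp 1 * τ * lam * Q' < 1)
    (hy : Φ * (τ * (ι₁ * lam + ι₂ / (2 * Q') + ι₃ / (4 * Q' ^ 2) + A' * Q' / 4)) < 1)
    (hθ : Φ * (exp 1 * τ * (ι₁ * lam) + (exp 1 * τ) ^ 2 * (ι₂ * lam) + (exp 1 * τ) ^ 3 * (ι₃ * lam ^ 2) +
      A' * (exp 1 * τ * Q') * ((exp 1 * τ * lam * Q') ^ 3 / (1 - exp 1 * τ * lam * Q'))) < 1)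
    (hu₁ : 4 * Q' ≤ Q) (hu₂ : 2 * τ * ψ * Q' ≤ Q)
    (hclose : A' * (4 * Q') ^ 3 * (4 * σ * lam * Q' / (1 - 4 * σ * lam * Q')) +
      exp 1 * ψ * (2 * τ * ψ * Q') ^ 2 * (τ * (ι₁ * lam + ι₂ / (2 * Q') + ι₃ / (4 * Q' ^ 2) + A' * Q' / 4)) *
        (Φ * (τ * (ι₁ * lam + ι₂ / (2 * Q') + ι₃ / (4 * Q' ^ 2) + A' * Q' / 4)) /
          (1 - Φ * (τ * (ι₁ * lam + ι₂ / (2 * Q') + ι₃ / (4 * Q' ^ 2) + A' * Q' / 4)))) ≤ A * Q ^ 3) :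
    ∀ k ≤ K, ∀ p, 3 ≤ p → p ≤ D → b k p ≤ A * lam ^ (p - 1) * Q ^ p := by
  have hg1' : 0 < 1 - g := sub_pos.2 hg1
  have hg₃1' : 0 < 1 - g₃ := sub_pos.2 hg₃1
  have hA'0 : 0 ≤ A' := le_trans (by positivity) hA'ge
  have hx10 : 0 ≤ 4 * σ * lam * Q' / (1 - 4 * σ * lam * Q') := div_nonneg (by positivity) (sub_nonneg.2 hx₁.le)
  have hw : 1 ≤ (2 * τ * Q' * lam)⁻¹ := (one_le_inv₀ (by positivity)).2 (by linarith)
  set Y := ι₁ * lam + ι₂ / (2 * Q') + ι₃ / (4 * Q' ^ 2) + A' * Q' / 4 with hY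
  suffices H : ∀ k ≤ K, ∀ k' ≤ k, ∀ p, 3 ≤ p → p ≤ D → b k' p ≤ A * lam ^ (p - 1) * Q ^ p from
    fun k hk p hp hpD => H k hk k le_rfl p hp hpD
  intro k
  induction k with
  | zero => intro _ k' hk' p hp hpD; rw [Nat.le_zero.1 hk']; exact h0 p hp hpD
  | succ k ih =>
    intro hk1 k' hk' p hp hpD
    have hkK : k < K := Nat.lt_of_succ_le hk1
    have ih' := ih (Nat.le_of_succ_le hk1)
    rcases Nat.lt_succ_iff_lt_or_eq.1 (Nat.lt_succ_of_le hk') with hlt | rfl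
    · exact ih' k' (Nat.lt_succ_iff.1 hlt) p hp hpD
    · have hD3 : 3 ≤ D := hp.trans hpD
      -- degrees ≥ 8: the measured profile from T1 applied to `μ` with the six-leg entry zeroed
      set μ4 : ℕ → ℕ → ℝ := fun k m => if 4 ≤ m then μ k m else 0 with hμ4
      have hμ4hyp : ∀ m, 3 ≤ m → m ≤ D → μ4 k m ≤ ∑ k' ∈ range (k + 1), c₁ * c₂ ^ m * g ^ ((m - 2) * (k + 1 - k')) * b k' m := by
        intro m hm3 hmD
        rw [hμ4]; dsimp only
        split_ifs with h4
        · exact hμ k hkK m h4 hmD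
        · exact sum_nonneg fun k' _ => by have := hb0 k' m; positivity
      have hprof : ∀ m, 4 ≤ m → m ≤ D → μ k m ≤ A' * lam ^ (m - 1) * Q' ^ m := by
        intro m hm4 hmD
        have hT1 := towerMeasured_le_profile (D := D) (μ := μ4) hA hlam.le hQ hg0 hg1 hc₁ hc₂ hb0 hμ4hyp ih' (by omega) hmD
        rw [hμ4] at hT1; dsimp only at hT1; rw [if_pos hm4] at hT1
        refine hT1.trans ?_
        have : 0 ≤ c₁ * A / ((1 - g) * g ^ 2) := by positivity
        have : 0 ≤ c₂ * g * Q := by positivity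
        gcongr
      -- six legs: the import `ι₃ λ²`
      have hμ3' : μ k 3 ≤ ι₃ * lam ^ 2 := by
        have h := towerMeasured_three_le hA hQ hg₃0 hg₃1 hc₁ hc₂ hb0 (hμ3 k hkK hD3) (fun k' hk' => ih' k' hk' 3 le_rfl hD3)
        exact h.trans (mul_le_mul_of_nonneg_right hι₃ge (sq_nonneg lam))
      -- Chernoff data
      have hG := sum_fourPiece_le (D := D) hτ hlam hQ'0 hA'0 (hμ0 k) (hι₁ k hkK) (hι₂ k hkK) hμ3' hprof
      have hG0 : 0 ≤ τ * Y := (sum_nonneg fun δ _ => by have := hμ0 k δ; positivity).trans hG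
      have hY0' : 0 ≤ Y := (mul_nonneg_iff_of_pos_left hτ).1 hG0
      have hVb := towerV_le_fourPiece hτ.le hlam.le hQ'0.le hA'0 (hμ0 k) (hι₁ k hkK) (hι₂ k hkK) hμ3' hprof hx₃
      have hFO := towerFO_le_of_four_le hσ hA'0 hlam.le hQ'0.le (hμ0 k) hprof hx₁ hp (D := D)
      have hT2 := towerStep_le_of_chernoff (D := D) hΦ hψ hτ.le (hμ0 k) hw hFO hG hVb hy hθ
        (fun N hN hguard => hstep k hkK N hN p hp hpD hguard)
      refine hT2.trans ?_
      have hinv : (((2 * τ * Q' * lam)⁻¹) ^ (p - 1))⁻¹ = (2 * τ * Q' * lam) ^ (p - 1) := by rw [inv_pow, inv_inv]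
      rw [hinv]
      have hyq0 : 0 ≤ Φ * (τ * Y) / (1 - Φ * (τ * Y)) := div_nonneg (by positivity) (sub_nonneg.2 hy.le)
      obtain ⟨r, rfl⟩ : ∃ r, p = 3 + r := ⟨p - 3, by omega⟩
      have h4 : (4 * Q') ^ (3 + r) ≤ (4 * Q') ^ 3 * Q ^ r := by
        rw [pow_add]; exact mul_le_mul_of_nonneg_left (pow_le_pow_left₀ (by positivity) hu₁ r) (by positivity)
      have h2 : ψ ^ (3 + r) * (2 * τ * Q' * lam) ^ (3 + r - 1) ≤ lam ^ (3 + r - 1) * ψ * ((2 * τ * ψ * Q') ^ 2 * Q ^ r) := by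
        have heq : ψ ^ (3 + r) * (2 * τ * Q' * lam) ^ (3 + r - 1) = lam ^ (3 + r - 1) * ψ * ((2 * τ * ψ * Q') ^ 2 * (2 * τ * ψ * Q') ^ r) := by
          rw [show 3 + r - 1 = r + 2 by omega, show 3 + r = r + 2 + 1 by omega]
          ring
        rw [heq]
        have hr : (2 * τ * ψ * Q') ^ r ≤ Q ^ r := pow_le_pow_left₀ (by positivity) hu₂ r
        exact mul_le_mul_of_nonneg_left (mul_le_mul_of_nonneg_left hr (by positivity)) (by positivity)
      set X₁ := 4 * σ * lam * Q' / (1 - 4 * σ * lam * Q') with hX₁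
      set Z := Φ * (τ * Y) / (1 - Φ * (τ * Y)) with hZ
      calc A' * lam ^ (3 + r - 1) * (4 * Q') ^ (3 + r) * X₁ + exp 1 * ψ ^ (3 + r) * (2 * τ * Q' * lam) ^ (3 + r - 1) * (τ * Y) * Z
          ≤ A' * lam ^ (3 + r - 1) * ((4 * Q') ^ 3 * Q ^ r) * X₁ + exp 1 * (lam ^ (3 + r - 1) * ψ * ((2 * τ * ψ * Q') ^ 2 * Q ^ r)) * (τ * Y) * Z := by
            have : exp 1 * ψ ^ (3 + r) * (2 * τ * Q' * lam) ^ (3 + r - 1) = exp 1 * (ψ ^ (3 + r) * (2 * τ * Q' * lam) ^ (3 + r - 1)) := by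
              ring
            rw [this]
            gcongr
        _ = lam ^ (3 + r - 1) * Q ^ r * (A' * (4 * Q') ^ 3 * X₁ + exp 1 * ψ * (2 * τ * ψ * Q') ^ 2 * (τ * Y) * Z) := by ring
        _ ≤ lam ^ (3 + r - 1) * Q ^ r * (A * Q ^ 3) := mul_le_mul_of_nonneg_left hclose (by positivity)
        _ = A * lam ^ (3 + r - 1) * Q ^ (3 + r) := by rw [pow_add]; ring

end Summit.HubbardSuperconductivity.HubbardSuperconductivity.Theorems.EngineV8

end
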